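import Literature.NumberTheory.LFunctions.KloostermanFractionsComplementaryDivisor
import HarnessLib

/-!
# Bilinear forms with Kloosterman fractions: the phase of a pair after reciprocity (B–C §4.1.3)

Topic `NumberTheory/LFunctions`.  S. Bettin, V. Chandee, *Trilinear forms with Kloosterman
fractions*, Adv. Math. 328 (2018), §4.1.3 (following Duke–Friedlander–Iwaniec, Invent. Math.
128 (1997)), case `A = 1`, `𝔭ᵢ = 𝔮ᵢ = 1`, `ℓ₂ = ℓ₂'` (the two copies produced by the
Cauchy–Schwarz of `KloostermanFractionsOffDiagCS.lean` share `ℓ₂, n₁, n₂, c`).  After expanding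
`|V|²` one meets, for a pair `(ℓ₁,d), (ℓ₁',d')`, the product of phases
`E(ℓ₁,d) conj E(ℓ₁',d')`, `E(ℓ₁,d) = e(-kd (bℓ₂n₂)‾/n₁) conj e(-kd (-bℓ₁n₁)‾/n₂)`.  The source
transforms it with "the congruence relation `(αγ)‾/β + (βγ)‾/α + (αβ)‾/γ ≡ 1/(αβγ) (mod 1)`,
which holds for `α,β,γ` pairwise coprime" into "`ϑΔ (ℓ̃₂ℓ̃₂'b𝔭₂𝔮₂n₂')‾/(ℓ̃₁ℓ̃₁'𝔮₁𝔭₁n₁') -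
a₂(dℓ̃₁'-d'ℓ̃₁)/(bℓ̃₁ℓ̃₁'𝔭₁n₁'𝔮₁𝔮₂n₂') + …`", i.e. a Kloosterman fraction in `n₂` modulo
`ℓ₁ℓ₁'n₁`, a small smooth twist, and terms not depending on `n₂` (via the congruence (fja)).

This file PROVES that transformation with explicit algebra (`kfw_pair_final`): with
`S = ℓ₁ℓ₁'n₁`, `Y = dℓ₁' - d'ℓ₁`, `σ₁ = (bℓ₂)‾^{(n₁)}`, `σ = b̄^{(S)}`,
`a = (-k(d-d')) σ₁ ℓ₁ℓ₁' + (kY) σ`,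

  `E(ℓ₁,d) conj E(ℓ₁',d') = e(kY (n₂S)‾^{(b)}/b) · e(-kY/(bS n₂)) · e(a n̄₂^{(S)}/S)`,

the first factor depending on `n₂` only modulo `b` (instead of (fja) we simply keep it: it is
constant on the progressions met later), and `a bℓ₂ ≡ kΔ' (mod S)` with
`Δ' = Yℓ₂ - (d-d')ℓ₁ℓ₁'` (`kfw_freq_congr`; the source's `Δ` is `ℓ₂Δ'`).  Steps:
`kfw_second_modulus_zmod`, `kfw_pair_phase` (the phase of the pair as
`e(-k(d-d')(bℓ₂n₂)‾/n₁) e(-kY (bℓ₁ℓ₁'n₁)‾/n₂)`), `kfw_recip` (two-term reciprocity, from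
`KI_e_inv_crt`), `kfw_b_split` (CRT split of the modulus `bS`), `kfw_lift` (the modulus `n₁`
lifted to `S`).

## References

* S. Bettin, V. Chandee, Adv. Math. 328 (2018) 1234–1262 (arXiv:1502.00769), §4.1.2 (vha),
  §4.1.3 (cond:3congruence), (fvw), (afed). [BettinChandee2018]
* W. Duke, J. Friedlander, H. Iwaniec, Invent. Math. 128 (1997) 23–43. [DukeFriedlanderIwaniec1997]
-/

noncomputable section

open Finset

namespace Literature.NumberTheory.LFunctions

/-! ### Small phase identities -/

/-- `conj e(a v/q) = e((-a) v/q)` for natural `v`, `q`. [folklore] -/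
theorem kfw_conj_e (a : ℤ) (v q : ℕ) :
    (starRingEnd ℂ) (Complex.exp (2 * Real.pi * Complex.I * ((a : ℂ) * (v : ℂ) / (q : ℂ)))) =
      Complex.exp (2 * Real.pi * Complex.I * (((-a : ℤ) : ℂ) * (v : ℂ) / (q : ℂ))) := by
  rw [← Complex.exp_conj]
  congr 1
  simp only [map_mul, map_div₀, map_ofNat, Complex.conj_ofReal, Complex.conj_I, map_intCast,
    map_natCast]
  push_cast
  ring

/-- `e(a v/q) e(a' v/q) = e((a + a') v/q)`. [folklore] -/
theorem kfw_e_mul_e (a a' : ℤ) (v q : ℕ) :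
    Complex.exp (2 * Real.pi * Complex.I * ((a : ℂ) * (v : ℂ) / (q : ℂ))) *
        Complex.exp (2 * Real.pi * Complex.I * ((a' : ℂ) * (v : ℂ) / (q : ℂ))) =
      Complex.exp (2 * Real.pi * Complex.I * (((a + a' : ℤ) : ℂ) * (v : ℂ) / (q : ℂ))) := by
  rw [← Complex.exp_add]
  congr 1
  push_cast
  ring

/-- `e(a v/q) e((-a) v/q) = 1`. [folklore] -/
theorem kfw_e_mul_e_neg (a : ℤ) (v q : ℕ) :
    Complex.exp (2 * Real.pi * Complex.I * ((a : ℂ) * (v : ℂ) / (q : ℂ))) *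
        Complex.exp (2 * Real.pi * Complex.I * (((-a : ℤ) : ℂ) * (v : ℂ) / (q : ℂ))) = 1 := by
  rw [kfw_e_mul_e, show a + -a = 0 by ring]
  simp

/-! ### The phase of the second modulus: `e(kd (−bℓ₁n₁)‾/n₂) e(−kd' (−bℓ₁'n₁)‾/n₂) = e(−kY (bℓ₁ℓ₁'n₁)‾/n₂)` -/

/-- In `ℤ/n₂`, with `b, ℓ₁, ℓ₁', n₁` units:
`kd (−bℓ₁n₁)⁻¹ − kd' (−bℓ₁'n₁)⁻¹ = −k(dℓ₁' − d'ℓ₁) (bℓ₁ℓ₁'n₁)⁻¹`. [folklore] -/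
theorem kfw_second_modulus_zmod {n₂ : ℕ} (k d d' : ℤ) {b ℓ₁ ℓ₁' n₁ : ℕ}
    (hu : IsUnit ((b * (ℓ₁ * ℓ₁' * n₁) : ℕ) : ZMod n₂)) :
    (k * d : ZMod n₂) * ((b * (-(ℓ₁ * n₁ : ℤ)) : ℤ) : ZMod n₂)⁻¹ -
        (k * d' : ZMod n₂) * ((b * (-(ℓ₁' * n₁ : ℤ)) : ℤ) : ZMod n₂)⁻¹ =
      ((-(k * (d * ℓ₁' - d' * ℓ₁)) : ℤ) : ZMod n₂) *
        ((b * (ℓ₁ * ℓ₁' * n₁) : ℕ) : ZMod n₂)⁻¹ := by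
  -- all of `b, ℓ₁, ℓ₁', n₁` are units modulo `n₂`
  have hU := hu
  set U : ZMod n₂ := ((b * (ℓ₁ * ℓ₁' * n₁) : ℕ) : ZMod n₂) with hUdef
  have hUinv : U * U⁻¹ = 1 := ZMod.mul_inv_of_unit _ hU
  -- the two inverses times `U`
  have h1 : ((b * (-(ℓ₁ * n₁ : ℤ)) : ℤ) : ZMod n₂)⁻¹ * U = -(ℓ₁' : ZMod n₂) := by
    have hv : IsUnit (((b * (-(ℓ₁ * n₁ : ℤ)) : ℤ) : ZMod n₂)) := by
      -- it divides the unit `U` up to sign: `(b(-ℓ₁n₁)) * (-ℓ₁') = U`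
      have : ((b * (-(ℓ₁ * n₁ : ℤ)) : ℤ) : ZMod n₂) * (-(ℓ₁' : ZMod n₂)) = U := by
        rw [hUdef]; push_cast; ring
      exact isUnit_of_mul_isUnit_left (this ▸ hU)
    have hvinv := ZMod.inv_mul_of_unit _ hv
    calc ((b * (-(ℓ₁ * n₁ : ℤ)) : ℤ) : ZMod n₂)⁻¹ * U
        = ((b * (-(ℓ₁ * n₁ : ℤ)) : ℤ) : ZMod n₂)⁻¹ *
            (((b * (-(ℓ₁ * n₁ : ℤ)) : ℤ) : ZMod n₂) * (-(ℓ₁' : ZMod n₂))) := by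
          rw [hUdef]; push_cast; ring
      _ = -(ℓ₁' : ZMod n₂) := by rw [← mul_assoc, hvinv, one_mul]
  have h2 : ((b * (-(ℓ₁' * n₁ : ℤ)) : ℤ) : ZMod n₂)⁻¹ * U = -(ℓ₁ : ZMod n₂) := by
    have hv : IsUnit (((b * (-(ℓ₁' * n₁ : ℤ)) : ℤ) : ZMod n₂)) := by
      have : ((b * (-(ℓ₁' * n₁ : ℤ)) : ℤ) : ZMod n₂) * (-(ℓ₁ : ZMod n₂)) = U := by
        rw [hUdef]; push_cast; ring
      exact isUnit_of_mul_isUnit_left (this ▸ hU)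
    have hvinv := ZMod.inv_mul_of_unit _ hv
    calc ((b * (-(ℓ₁' * n₁ : ℤ)) : ℤ) : ZMod n₂)⁻¹ * U
        = ((b * (-(ℓ₁' * n₁ : ℤ)) : ℤ) : ZMod n₂)⁻¹ *
            (((b * (-(ℓ₁' * n₁ : ℤ)) : ℤ) : ZMod n₂) * (-(ℓ₁ : ZMod n₂))) := by
          rw [hUdef]; push_cast; ring
      _ = -(ℓ₁ : ZMod n₂) := by rw [← mul_assoc, hvinv, one_mul]
  -- compare after multiplying by the unit `U`
  set C : ZMod n₂ := ((-(k * (d * ℓ₁' - d' * ℓ₁)) : ℤ) : ZMod n₂) with hC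
  have eX : (k * d : ZMod n₂) * ((b * (-(ℓ₁ * n₁ : ℤ)) : ℤ) : ZMod n₂)⁻¹ * U =
      (k * d : ZMod n₂) * (-(ℓ₁' : ZMod n₂)) := by rw [mul_assoc, h1]
  have eX' : (k * d' : ZMod n₂) * ((b * (-(ℓ₁' * n₁ : ℤ)) : ℤ) : ZMod n₂)⁻¹ * U =
      (k * d' : ZMod n₂) * (-(ℓ₁ : ZMod n₂)) := by rw [mul_assoc, h2]
  have key : ((k * d : ZMod n₂) * ((b * (-(ℓ₁ * n₁ : ℤ)) : ℤ) : ZMod n₂)⁻¹ -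
        (k * d' : ZMod n₂) * ((b * (-(ℓ₁' * n₁ : ℤ)) : ℤ) : ZMod n₂)⁻¹) * U = C := by
    rw [sub_mul, eX, eX', hC]
    push_cast
    ring
  calc (k * d : ZMod n₂) * ((b * (-(ℓ₁ * n₁ : ℤ)) : ℤ) : ZMod n₂)⁻¹ -
        (k * d' : ZMod n₂) * ((b * (-(ℓ₁' * n₁ : ℤ)) : ℤ) : ZMod n₂)⁻¹
      = ((k * d : ZMod n₂) * ((b * (-(ℓ₁ * n₁ : ℤ)) : ℤ) : ZMod n₂)⁻¹ -
          (k * d' : ZMod n₂) * ((b * (-(ℓ₁' * n₁ : ℤ)) : ℤ) : ZMod n₂)⁻¹) * (U * U⁻¹) := by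
        rw [hUinv, mul_one]
    _ = (((k * d : ZMod n₂) * ((b * (-(ℓ₁ * n₁ : ℤ)) : ℤ) : ZMod n₂)⁻¹ -
          (k * d' : ZMod n₂) * ((b * (-(ℓ₁' * n₁ : ℤ)) : ℤ) : ZMod n₂)⁻¹) * U) * U⁻¹ := by ring
    _ = C * U⁻¹ := by rw [key]

/-- **The phase of a pair `(ℓ₁,d), (ℓ₁',d')`** (same `ℓ₂, n₁, n₂`): with
`E(ℓ₁,d) = e(-kd (bℓ₂n₂)‾/n₁) conj e(-kd (-bℓ₁n₁)‾/n₂)` (the summand of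
`KloostermanFractionsOffDiagCS.lean`), if `bℓ₁ℓ₁'n₁` is invertible modulo `n₂` then
`E(ℓ₁,d) conj E(ℓ₁',d') = e(-k(d-d') (bℓ₂n₂)‾/n₁) · e(-kY (bℓ₁ℓ₁'n₁)‾/n₂)`, `Y = dℓ₁' - d'ℓ₁`
(Bettin–Chandee (vha) with `A = 1`, `𝔭ᵢ = 𝔮ᵢ = 1`, `ℓ₂ = ℓ₂'`). [cite: BettinChandee2018, §4.1.2 (vha)] -/
theorem kfw_pair_phase (k d d' : ℤ) (b ℓ₁ ℓ₁' ℓ₂ : ℕ) {n₁ n₂ : ℕ} (hn₂ : 0 < n₂)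
    (hu : IsUnit ((b * (ℓ₁ * ℓ₁' * n₁) : ℕ) : ZMod n₂)) :
    (Complex.exp (2 * Real.pi * Complex.I *
        (((-(k * d) : ℤ) : ℂ) * (((((b * (ℓ₂ * n₂ : ℤ) : ℤ) : ZMod n₁)⁻¹).val : ℕ) : ℂ) /
          (n₁ : ℂ))) *
      (starRingEnd ℂ) (Complex.exp (2 * Real.pi * Complex.I *
        (((-(k * d) : ℤ) : ℂ) * (((((b * (-(ℓ₁ * n₁ : ℤ)) : ℤ) : ZMod n₂)⁻¹).val : ℕ) : ℂ) /
          (n₂ : ℂ))))) *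
    (starRingEnd ℂ) (Complex.exp (2 * Real.pi * Complex.I *
        (((-(k * d') : ℤ) : ℂ) * (((((b * (ℓ₂ * n₂ : ℤ) : ℤ) : ZMod n₁)⁻¹).val : ℕ) : ℂ) /
          (n₁ : ℂ))) *
      (starRingEnd ℂ) (Complex.exp (2 * Real.pi * Complex.I *
        (((-(k * d') : ℤ) : ℂ) * (((((b * (-(ℓ₁' * n₁ : ℤ)) : ℤ) : ZMod n₂)⁻¹).val : ℕ) : ℂ) /
          (n₂ : ℂ))))) =
    Complex.exp (2 * Real.pi * Complex.I *
        (((-(k * (d - d')) : ℤ) : ℂ) * (((((b * (ℓ₂ * n₂ : ℤ) : ℤ) : ZMod n₁)⁻¹).val : ℕ) : ℂ) /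
          (n₁ : ℂ))) *
      Complex.exp (2 * Real.pi * Complex.I *
        (((-(k * (d * ℓ₁' - d' * ℓ₁)) : ℤ) : ℂ) *
          (((((b * (ℓ₁ * ℓ₁' * n₁) : ℕ) : ZMod n₂)⁻¹).val : ℕ) : ℂ) / (n₂ : ℂ))) := by
  haveI : NeZero n₂ := ⟨hn₂.ne'⟩
  -- notation
  set u : ℕ := (((b * (ℓ₂ * n₂ : ℤ) : ℤ) : ZMod n₁)⁻¹).val with hu'
  set v : ℕ := (((b * (-(ℓ₁ * n₁ : ℤ)) : ℤ) : ZMod n₂)⁻¹).val with hv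
  set v' : ℕ := (((b * (-(ℓ₁' * n₁ : ℤ)) : ℤ) : ZMod n₂)⁻¹).val with hv'
  set w : ℕ := (((b * (ℓ₁ * ℓ₁' * n₁) : ℕ) : ZMod n₂)⁻¹).val with hw
  -- conjugates
  rw [map_mul, Complex.conj_conj, kfw_conj_e, kfw_conj_e]
  -- regroup: (modulus n₁ factors) * (modulus n₂ factors)
  have hregroup : ∀ (A B C D' : ℂ), A * B * (C * D') = (A * C) * (B * D') := fun _ _ _ _ => by ring
  rw [hregroup, kfw_e_mul_e]
  rw [show -(k * d) + -(-(k * d')) = -(k * (d - d')) by ring]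
  congr 1
  -- the modulus-`n₂` factor: `e((kd) v/n₂) e((-kd') v'/n₂) = e(-kY w/n₂)`
  rw [show (-(-(k * d)) : ℤ) = k * d by ring, ← Complex.exp_add]
  have hsum : 2 * (Real.pi : ℂ) * Complex.I * (((k * d : ℤ) : ℂ) * (v : ℂ) / (n₂ : ℂ)) +
      2 * Real.pi * Complex.I * (((-(k * d') : ℤ) : ℂ) * (v' : ℂ) / (n₂ : ℂ)) =
      2 * Real.pi * Complex.I * (((1 : ℤ) : ℂ) * (((k * d * v + -(k * d') * v' : ℤ)) : ℂ) /
        (n₂ : ℂ)) := by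
    push_cast; ring
  rw [hsum]
  have hcong : (k * d * v + -(k * d') * v' : ℤ) ≡
      (-(k * (d * ℓ₁' - d' * ℓ₁))) * (w : ℤ) [ZMOD n₂] := by
    rw [← ZMod.intCast_eq_intCast_iff]
    push_cast
    rw [hv, hv', hw, ZMod.natCast_zmod_val, ZMod.natCast_zmod_val, ZMod.natCast_zmod_val]
    have h := kfw_second_modulus_zmod k d d' hu
    push_cast at h ⊢
    linear_combination h
  rw [kfs_e_congr_int 1 hn₂ hcong]
  congr 1
  push_cast
  ring

/-! ### Reciprocity and the splitting modulo `b` -/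

/-- **Reciprocity** (`ᾱ/β + β̄/α ≡ 1/(αβ) (mod 1)`): for coprime `B, n ≥ 1` with `B > 1`,
`e(a B̄^{(n)}/n) = e(a/(Bn)) · e((-a) n̄^{(B)}/B)`. [cite: BettinChandee2018, §2 (outline) and §4.1.3 (cond:3congruence)] -/
theorem kfw_recip {B n : ℕ} (hB : 1 < B) (hn : 0 < n) (hcop : B.Coprime n) (a : ℤ) :
    Complex.exp (2 * Real.pi * Complex.I *
        ((a : ℂ) * (((((B : ℕ) : ZMod n)⁻¹).val : ℕ) : ℂ) / (n : ℂ))) =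
      Complex.exp (2 * Real.pi * Complex.I * ((a : ℂ) / ((B * n : ℕ) : ℂ))) *
        Complex.exp (2 * Real.pi * Complex.I *
          (((-a : ℤ) : ℂ) * (((((n : ℕ) : ZMod B)⁻¹).val : ℕ) : ℂ) / (B : ℂ))) := by
  have hB0 : 0 < B := lt_trans zero_lt_one hB
  haveI : NeZero (B * n) := ⟨(Nat.mul_pos hB0 hn).ne'⟩
  haveI : Fact (1 < B * n) := ⟨lt_of_lt_of_le hB (Nat.le_mul_of_pos_right _ hn)⟩
  have hx : IsUnit (((1 : ℤ) : ZMod (B * n))) := by rw [Int.cast_one]; exact isUnit_one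
  have h := KI_e_inv_crt hB0 hn hcop a hx
  have h1 : ((((1 : ℤ) : ZMod (B * n))⁻¹).val : ℕ) = 1 := by
    rw [Int.cast_one, ZMod.inv_eq_of_mul_eq_one (B * n) 1 1 (one_mul 1), ZMod.val_one]
  rw [h1] at h
  simp only [Nat.cast_one, mul_one, one_mul, Int.cast_natCast] at h
  -- `h : e(a/(Bn)) = e(a n̄/B) e(a B̄/n)`; multiply by `e(-a n̄/B)`
  have hPP := kfw_e_mul_e_neg a ((((n : ℕ) : ZMod B)⁻¹).val) B
  calc Complex.exp (2 * Real.pi * Complex.I *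
        ((a : ℂ) * (((((B : ℕ) : ZMod n)⁻¹).val : ℕ) : ℂ) / (n : ℂ)))
      = Complex.exp (2 * Real.pi * Complex.I *
          ((a : ℂ) * (((((B : ℕ) : ZMod n)⁻¹).val : ℕ) : ℂ) / (n : ℂ))) *
        (Complex.exp (2 * Real.pi * Complex.I *
            ((a : ℂ) * (((((n : ℕ) : ZMod B)⁻¹).val : ℕ) : ℂ) / (B : ℂ))) *
          Complex.exp (2 * Real.pi * Complex.I *
            (((-a : ℤ) : ℂ) * (((((n : ℕ) : ZMod B)⁻¹).val : ℕ) : ℂ) / (B : ℂ)))) := by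
        rw [hPP, mul_one]
    _ = (Complex.exp (2 * Real.pi * Complex.I *
            ((a : ℂ) * (((((n : ℕ) : ZMod B)⁻¹).val : ℕ) : ℂ) / (B : ℂ))) *
          Complex.exp (2 * Real.pi * Complex.I *
            ((a : ℂ) * (((((B : ℕ) : ZMod n)⁻¹).val : ℕ) : ℂ) / (n : ℂ)))) *
        Complex.exp (2 * Real.pi * Complex.I *
            (((-a : ℤ) : ℂ) * (((((n : ℕ) : ZMod B)⁻¹).val : ℕ) : ℂ) / (B : ℂ))) := by ring
    _ = _ := by rw [← h]

/-- **Splitting off the modulus `b`**: for coprime `b, S ≥ 1`, `x` invertible modulo `bS` and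
`σ = b̄^{(S)}`, `e(a x̄^{(bS)}/(bS)) = e(a (xS)‾^{(b)}/b) · e((aσ) x̄^{(S)}/S)`; the first factor only
depends on `x (mod b)`. [folklore] -/
theorem kfw_b_split {b S : ℕ} (hb : 0 < b) (hS : 0 < S) (hcop : b.Coprime S) (a : ℤ) {x : ℤ}
    (hx : IsUnit (x : ZMod (b * S))) :
    Complex.exp (2 * Real.pi * Complex.I *
        ((a : ℂ) * ((((x : ZMod (b * S))⁻¹).val : ℕ) : ℂ) / ((b * S : ℕ) : ℂ))) =
      Complex.exp (2 * Real.pi * Complex.I *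
          ((a : ℂ) * (((((x * S : ℤ) : ZMod b)⁻¹).val : ℕ) : ℂ) / (b : ℂ))) *
        Complex.exp (2 * Real.pi * Complex.I *
          (((a * (((b : ZMod S)⁻¹).val : ℕ) : ℤ) : ℂ) * ((((x : ZMod S)⁻¹).val : ℕ) : ℂ) /
            (S : ℂ))) := by
  have hx₂ : IsUnit (x : ZMod S) := by
    have := hx.map (ZMod.castHom (dvd_mul_left S b) (ZMod S))
    rwa [map_intCast] at this
  rw [KI_e_inv_crt hb hS hcop a hx, KI_e_inv_mul_unit hS a hcop hx₂]

/-- **Lifting the modulus `n₁` to `S = t n₁`**: for `(c, n₁) = 1`, `σ = c̄^{(n₁)}`, and `x`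
invertible modulo `S`, `e(A (xc)‾^{(n₁)}/n₁) = e((Aσt) x̄^{(S)}/S)`. [folklore] -/
theorem kfw_lift (A : ℤ) {n₁ t S : ℕ} (hS : S = t * n₁) (hn₁ : 0 < n₁) (ht : 0 < t) {c : ℕ}
    (hc : c.Coprime n₁) {x : ℤ} (hxS : IsUnit (x : ZMod S)) :
    Complex.exp (2 * Real.pi * Complex.I *
        ((A : ℂ) * (((((x * c : ℤ) : ZMod n₁)⁻¹).val : ℕ) : ℂ) / (n₁ : ℂ))) =
      Complex.exp (2 * Real.pi * Complex.I *
        (((A * (((c : ZMod n₁)⁻¹).val : ℕ) * t : ℤ) : ℂ) * ((((x : ZMod S)⁻¹).val : ℕ) : ℂ) /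
          (S : ℂ))) := by
  have hS0 : 0 < S := by rw [hS]; exact Nat.mul_pos ht hn₁
  haveI : NeZero S := ⟨hS0.ne'⟩
  haveI : NeZero n₁ := ⟨hn₁.ne'⟩
  have hdvd : n₁ ∣ S := ⟨t, by rw [hS, mul_comm]⟩
  have hx₁ : IsUnit (x : ZMod n₁) := by
    have := hxS.map (ZMod.castHom hdvd (ZMod n₁))
    rwa [map_intCast] at this
  rw [KI_e_inv_mul_unit hn₁ A hc hx₁]
  -- the inverse modulo `n₁` is the inverse modulo `S` reduced
  have hred : (((x : ZMod n₁)⁻¹).val : ℕ) = (((x : ZMod S)⁻¹).val : ℕ) % n₁ :=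
    (KI_inv_val_mod_int hdvd hxS).symm
  rw [hred, ← KI_e_mod _ hn₁]
  congr 1
  have hn0 : (n₁ : ℂ) ≠ 0 := by exact_mod_cast hn₁.ne'
  have ht0 : (t : ℂ) ≠ 0 := by exact_mod_cast ht.ne'
  rw [hS]
  push_cast
  field_simp

/-- `a bℓ₂ ≡ kΔ' (mod S)` for the combined frequency `a = (-k(d-d')) σ₁ t + (kY) σ` where
`σ₁ = (bℓ₂)‾^{(n₁)}`, `σ = b̄^{(S)}`, `S = t n₁` (`t = ℓ₁ℓ₁'`), `Y = dℓ₁' - d'ℓ₁`,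
`Δ' = Y ℓ₂ - (d - d') t`. [cite: BettinChandee2018, §4.1.3 (definition of Δ)] -/
theorem kfw_freq_congr (k d d' : ℤ) {b ℓ₂ n₁ t S : ℕ} (hS : S = t * n₁) (hn₁ : 0 < n₁)
    (ht : 0 < t) (hσ₁ : (b * ℓ₂).Coprime n₁) (hσ : b.Coprime S) (Y : ℤ) :
    ((((-(k * (d - d'))) * ((((b * ℓ₂ : ℕ) : ZMod n₁)⁻¹).val : ℕ) * t +
        (k * Y) * (((b : ZMod S)⁻¹).val : ℕ)) * (b * ℓ₂ : ℕ) : ℤ) : ZMod S) =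
      ((k * (Y * ℓ₂ - (d - d') * t) : ℤ) : ZMod S) := by
  haveI : NeZero n₁ := ⟨hn₁.ne'⟩
  have hS0 : 0 < S := by rw [hS]; exact Nat.mul_pos ht hn₁
  haveI : NeZero S := ⟨hS0.ne'⟩
  -- `σ b = 1` in `ℤ/S`
  have hσb : ((((b : ZMod S)⁻¹).val : ℕ) : ZMod S) * (b : ZMod S) = 1 := by
    rw [ZMod.natCast_zmod_val, ZMod.inv_mul_of_unit _ ((ZMod.isUnit_iff_coprime b S).mpr hσ)]
  -- `σ₁ (bℓ₂) = 1` in `ℤ/n₁`, hence `S = t n₁ ∣ t (σ₁ bℓ₂ - 1)`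
  have hu₁ : IsUnit ((b * ℓ₂ : ℕ) : ZMod n₁) := (ZMod.isUnit_iff_coprime _ _).mpr hσ₁
  have e1 : (((((b * ℓ₂ : ℕ) : ZMod n₁)⁻¹).val : ℕ) : ZMod n₁) * ((b * ℓ₂ : ℕ) : ZMod n₁) = 1 := by
    rw [ZMod.natCast_zmod_val, ZMod.inv_mul_of_unit _ hu₁]
  have h1 : (n₁ : ℤ) ∣
      ((((((b * ℓ₂ : ℕ) : ZMod n₁)⁻¹).val : ℕ) : ℤ) * ((b * ℓ₂ : ℕ) : ℤ) - 1) := by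
    rw [← ZMod.intCast_zmod_eq_zero_iff_dvd, Int.cast_sub, Int.cast_mul, Int.cast_natCast,
      Int.cast_natCast, Int.cast_one, e1, sub_self]
  have hdvd : (S : ℤ) ∣ (t : ℤ) *
      ((((((b * ℓ₂ : ℕ) : ZMod n₁)⁻¹).val : ℕ) : ℤ) * ((b * ℓ₂ : ℕ) : ℤ) - 1) := by
    rw [hS, Nat.cast_mul]; exact mul_dvd_mul_left (t : ℤ) h1
  have ht0 : ((((t : ℤ) *
      ((((((b * ℓ₂ : ℕ) : ZMod n₁)⁻¹).val : ℕ) : ℤ) * ((b * ℓ₂ : ℕ) : ℤ) - 1)) : ℤ) : ZMod S) = 0 :=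
    (ZMod.intCast_zmod_eq_zero_iff_dvd _ S).mpr hdvd
  push_cast at ht0 hσb ⊢
  linear_combination (-(k * (d - d')) : ZMod S) * ht0 + ((k : ZMod S) * Y * ℓ₂) * hσb

/-! ### The phase of a pair as a single Kloosterman fraction modulo `S = ℓ₁ℓ₁'n₁` -/

/-- **The phase of a pair, final form** (Bettin–Chandee §4.1.3 (fvw)–(afed) with `A = 1`,
`𝔭ᵢ = 𝔮ᵢ = 1`, `ℓ₂ = ℓ₂'`): with `S = ℓ₁ℓ₁'n₁`, `Y = dℓ₁' - d'ℓ₁`, `σ₁ = (bℓ₂)‾^{(n₁)}`,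
`σ = b̄^{(S)}` and `a = (-k(d-d')) σ₁ ℓ₁ℓ₁' + (kY) σ`,
`E(ℓ₁,d) conj E(ℓ₁',d') = e(kY (n₂S)‾^{(b)}/b) · e(-kY/(bS n₂)) · e(a n̄₂^{(S)}/S)`:
a unimodular factor depending only on `n₂ (mod b)`, a smooth twist, and a Kloosterman fraction
modulo `S` (the source: "the argument of the exponential becomes
`ϑ(Δ (ℓ̃₂ℓ̃₂'b𝔭₂𝔮₂n₂')‾/(ℓ̃₁ℓ̃₁'𝔮₁𝔭₁n₁') - a₂(dℓ̃₁'-d'ℓ̃₁)/(bℓ̃₁ℓ̃₁'𝔭₁n₁'𝔮₁𝔮₂n₂') + …)`";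
here `a bℓ₂ ≡ kΔ' (mod S)` by `kfw_freq_congr`). [cite: BettinChandee2018, §4.1.3 (fvw), (afed)] -/
theorem kfw_pair_final (k d d' : ℤ) {b ℓ₁ ℓ₁' ℓ₂ n₁ n₂ : ℕ} (hb : 0 < b) (hℓ₁ : 0 < ℓ₁)
    (hℓ₁' : 0 < ℓ₁') (hn₁ : 0 < n₁) (hn₂ : 0 < n₂) (hS1 : 1 < ℓ₁ * ℓ₁' * n₁)
    (hc₁ : (b * ℓ₂).Coprime n₁) (hbS : b.Coprime (ℓ₁ * ℓ₁' * n₁))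
    (hBn : (b * (ℓ₁ * ℓ₁' * n₁)).Coprime n₂) :
    (Complex.exp (2 * Real.pi * Complex.I *
        (((-(k * d) : ℤ) : ℂ) * (((((b * (ℓ₂ * n₂ : ℤ) : ℤ) : ZMod n₁)⁻¹).val : ℕ) : ℂ) /
          (n₁ : ℂ))) *
      (starRingEnd ℂ) (Complex.exp (2 * Real.pi * Complex.I *
        (((-(k * d) : ℤ) : ℂ) * (((((b * (-(ℓ₁ * n₁ : ℤ)) : ℤ) : ZMod n₂)⁻¹).val : ℕ) : ℂ) /
          (n₂ : ℂ))))) *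
    (starRingEnd ℂ) (Complex.exp (2 * Real.pi * Complex.I *
        (((-(k * d') : ℤ) : ℂ) * (((((b * (ℓ₂ * n₂ : ℤ) : ℤ) : ZMod n₁)⁻¹).val : ℕ) : ℂ) /
          (n₁ : ℂ))) *
      (starRingEnd ℂ) (Complex.exp (2 * Real.pi * Complex.I *
        (((-(k * d') : ℤ) : ℂ) * (((((b * (-(ℓ₁' * n₁ : ℤ)) : ℤ) : ZMod n₂)⁻¹).val : ℕ) : ℂ) /
          (n₂ : ℂ))))) =
    Complex.exp (2 * Real.pi * Complex.I *
        (((k * (d * ℓ₁' - d' * ℓ₁) : ℤ) : ℂ) *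
          (((((((n₂ : ℤ) * (ℓ₁ * ℓ₁' * n₁ : ℕ) : ℤ)) : ZMod b)⁻¹).val : ℕ) : ℂ) / (b : ℂ))) *
      Complex.exp (2 * Real.pi * Complex.I *
        (((-(k * (d * ℓ₁' - d' * ℓ₁)) : ℤ) : ℂ) / ((b * (ℓ₁ * ℓ₁' * n₁) * n₂ : ℕ) : ℂ))) *
      Complex.exp (2 * Real.pi * Complex.I *
        ((((-(k * (d - d'))) * ((((b * ℓ₂ : ℕ) : ZMod n₁)⁻¹).val : ℕ) * (ℓ₁ * ℓ₁' : ℕ) +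
            (k * (d * ℓ₁' - d' * ℓ₁)) * (((b : ZMod (ℓ₁ * ℓ₁' * n₁))⁻¹).val : ℕ) : ℤ) : ℂ) *
          (((((n₂ : ℤ) : ZMod (ℓ₁ * ℓ₁' * n₁))⁻¹).val : ℕ) : ℂ) / ((ℓ₁ * ℓ₁' * n₁ : ℕ) : ℂ))) := by
  set S : ℕ := ℓ₁ * ℓ₁' * n₁ with hSdef
  set Y : ℤ := d * ℓ₁' - d' * ℓ₁ with hY
  have hS0 : 0 < S := lt_trans zero_lt_one hS1
  haveI : NeZero S := ⟨hS0.ne'⟩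
  haveI : NeZero n₂ := ⟨hn₂.ne'⟩
  have ht : 0 < ℓ₁ * ℓ₁' := Nat.mul_pos hℓ₁ hℓ₁'
  -- Step 1: the pair phase
  have hu : IsUnit ((b * (ℓ₁ * ℓ₁' * n₁) : ℕ) : ZMod n₂) := (ZMod.isUnit_iff_coprime _ _).mpr hBn
  rw [kfw_pair_phase k d d' b ℓ₁ ℓ₁' ℓ₂ hn₂ hu]
  -- Step 2: the modulus-`n₁` factor lifted to modulus `S`
  have hn₂S : IsUnit ((n₂ : ℤ) : ZMod S) := by
    rw [Int.cast_natCast, ZMod.isUnit_iff_coprime]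
    exact (Nat.Coprime.coprime_mul_left hBn).symm
  have hcast₁ : ((b * (ℓ₂ * n₂ : ℤ) : ℤ) : ZMod n₁) = (((n₂ : ℤ) * (b * ℓ₂ : ℕ) : ℤ) : ZMod n₁) := by
    push_cast; ring
  have hlift := kfw_lift (-(k * (d - d'))) hSdef hn₁ ht hc₁ hn₂S
  rw [hcast₁, hlift]
  -- Step 3: reciprocity for the modulus-`n₂` factor, then split off `b`
  have hB1 : 1 < b * S := lt_of_lt_of_le hS1 (Nat.le_mul_of_pos_left _ hb)
  have hrec := kfw_recip hB1 hn₂ hBn (-(k * Y))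
  rw [hrec]
  have hn₂bS : IsUnit ((n₂ : ℤ) : ZMod (b * S)) := by
    rw [Int.cast_natCast, ZMod.isUnit_iff_coprime]; exact hBn.symm
  have hsplit := kfw_b_split hb hS0 hbS (k * Y) hn₂bS
  rw [show (-(-(k * Y)) : ℤ) = k * Y by ring, ← Int.cast_natCast (R := ZMod (b * S)) n₂, hsplit]
  -- Step 4: combine the two Kloosterman fractions modulo `S`
  have hcomb := kfw_e_mul_e
    (-(k * (d - d')) * ((((b * ℓ₂ : ℕ) : ZMod n₁)⁻¹).val : ℕ) * (ℓ₁ * ℓ₁' : ℕ))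
    (k * Y * (((b : ZMod S)⁻¹).val : ℕ)) ((((n₂ : ℤ) : ZMod S)⁻¹).val) S
  calc Complex.exp (2 * Real.pi * Complex.I *
          (((-(k * (d - d')) * ((((b * ℓ₂ : ℕ) : ZMod n₁)⁻¹).val : ℕ) * (ℓ₁ * ℓ₁' : ℕ) : ℤ) : ℂ) *
            (((((n₂ : ℤ) : ZMod S)⁻¹).val : ℕ) : ℂ) / (S : ℂ))) *
        (Complex.exp (2 * Real.pi * Complex.I * (((-(k * Y) : ℤ) : ℂ) / ((b * S * n₂ : ℕ) : ℂ))) *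
          (Complex.exp (2 * Real.pi * Complex.I *
              (((k * Y : ℤ) : ℂ) * ((((((n₂ : ℤ) * S : ℤ) : ZMod b)⁻¹).val : ℕ) : ℂ) / (b : ℂ))) *
            Complex.exp (2 * Real.pi * Complex.I *
              (((k * Y * (((b : ZMod S)⁻¹).val : ℕ) : ℤ) : ℂ) *
                (((((n₂ : ℤ) : ZMod S)⁻¹).val : ℕ) : ℂ) / (S : ℂ)))))
      = Complex.exp (2 * Real.pi * Complex.I *
            (((k * Y : ℤ) : ℂ) * ((((((n₂ : ℤ) * S : ℤ) : ZMod b)⁻¹).val : ℕ) : ℂ) / (b : ℂ))) *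
          Complex.exp (2 * Real.pi * Complex.I * (((-(k * Y) : ℤ) : ℂ) / ((b * S * n₂ : ℕ) : ℂ))) *
          (Complex.exp (2 * Real.pi * Complex.I *
              (((-(k * (d - d')) * ((((b * ℓ₂ : ℕ) : ZMod n₁)⁻¹).val : ℕ) * (ℓ₁ * ℓ₁' : ℕ) : ℤ) :
                ℂ) * (((((n₂ : ℤ) : ZMod S)⁻¹).val : ℕ) : ℂ) / (S : ℂ))) *
            Complex.exp (2 * Real.pi * Complex.I *
              (((k * Y * (((b : ZMod S)⁻¹).val : ℕ) : ℤ) : ℂ) *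
                (((((n₂ : ℤ) : ZMod S)⁻¹).val : ℕ) : ℂ) / (S : ℂ)))) := by ring
    _ = _ := by rw [hcomb]

end Literature.NumberTheory.LFunctions

end
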